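import Summits.NavierStokesRegularity.NavierStokesRegularity.Theorems.HeredityAtOne.Negative.NoSwirlCapEighth
import Summits.NavierStokesRegularity.FluidComputer.PalasekTowerRegisterGlobalFloorsAtSlice
import Literature.Analysis.FluidPDE.AxisymmetricNoSwirlGlobalHolds

/-!
# The design-free strengthening S⁺ = `SliceHeredityAtOne` dies KINEMATICALLY: every `H^∞` signed swirl-free
# slice launches a lazy Gallay–Šverák-capped run (no Navier–Stokes dynamics left to do)

Cell `ns-blowup`, seat `refuter-ns-palasek-19249-disprove-1` (g2; DISPROVER on route `PalasekTowerBreakdown`, item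
stmt-NavierStokesRegularity-19249 `HeredityAtOne`). NEGATIVE-LANE lemmas (no positive Theses conclusion; S⁺ is the
strategy census's `@[conjecture]` strengthening, `Cruxes/HeredityAtOne/StrategyCensus.lean` §2(e), filed there as
"the vacuity-free refutation target"; restated here by its BODY, since `Theorems` may not import `Cruxes`), sorry-free,
no named fact.

THE POINT. The census template `not_sliceHeredityAtOne_of_lazy_envelope_slice` asks for an envelope slice `v` AND
an unforced finite-energy classical run of length `τ₂ − τ₁` from `v` inside the ceiling whose end is not a level-2
letter. This file DISCHARGES THE RUN for every smooth divergence-free `H^∞` single-signed swirl-free slice: the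
tree's Ladyzhenskaya–Ukhovskii–Yudovich theorem for `H^∞` data (`exists_isTaoSolutionOn_of_noSwirl` with the
discharged `tao2011_smooth_local_existence_holds`, `axisymmetricNoSwirl_enstrophy_apriori_holds` — NO spatial decay
of `v` is asked, which matters: a signed swirl-free slice has positive impulse `∫ r²η / 2`, hence a dipole tail
`|v| ≍ |x|⁻³`, and is NEVER a rapidly decaying Clay datum) gives a Tao-class run of ANY length, and the
Gallay–Šverák all-time cap with the number `0.35356` (`isNoSwirlCapConstant_eighth`) bounds its speed by
`0.35356 · √(√((∫η)(∫r²η)) · M)` throughout (`exists_capped_run_of_signedNoSwirlSlice`). Hence: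

* `not_sliceRun_letter_of_capped_signedNoSwirlSlice` — for ANY wide design with `c₁ ≤ c₂`, any level `k`, such a
  slice with `0.35356·(cap value) < c₁ Y_{k+1}` fails `SliceRun S k (Letter S (k+1))`: the capped run stays inside
  the ceiling and its terminal slice misses the level-`(k+1)` speed floor everywhere;
* `not_sliceHeredityAtOne_of_capped_signed_envelope_slice` — S⁺ is refuted by ONE pinned rigid quiet wide design
  with `c₁ ≤ c₂` and ONE smooth divergence-free `H^∞` signed swirl-free slice in its level-1 envelope
  (`Letter S 1 v`, `‖v‖ ≤ c₂ Y₁`) with `0.35356·(cap value) < c₁ Y₂` — a purely KINEMATIC remainder;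
* the companion `RestDesign.lean` (same seat) specialises to the rest design with readout radius `ρ` (datum `0`,
  force `0`, `c₁ = 1`, `c₂ = 5/3`), making every design constant of the remainder NUMERIC.

NUMBERS (wide rates `N_k = 256^{(11/10)^k}`, `Y_k = N_k^{13/10}`, `A_k = N_k^{23/10}`; `N₁ ≈ 445`, `Y₁ ≈ 2.78·10³`,
`Y₂ ≈ 6.14·10³ = 2.2099 Y₁`, `A₁ ≈ 1.2·10⁶`). The remainder asks for a signed swirl-free shape with
`sup_B |v| / √(√((∫η)(∫r²η))·M) > 0.35356 · Y₁/Y₂ = 0.1600` (times `sup_B|v|/Y₁ ≥ 1`). HILL'S SPHERICAL VORTEX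
(`η = A` on `|x| < a`): `∫η = (4π/3)A a³`, `∫r²η = (8π/15)A a⁵`, cap value `= 1.6277 A a²`, centre speed
`|v(0)| = A a²/3` (lab frame, `= 5U/2`), ratio `0.2048 > 0.1600` (margin 28 %; a thin uniform-core ring gives only
`1/(2√2 π) = 0.1125` and FAILS — fat signed blobs, not thin rings, pass the door). With `a ≍ 1/N₁` and
`A a²/3 ≍ Y₁` the strain `≍ A a ≍ N₁ Y₁ = A₁` and an `N₁`-loop at the vortical core carries circulation
`≍ A a / N₁² ≍ N₁^{3/10}` — the level-1 letter is dimensionally consistent with the Hill scaling; the smooth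
(nested-plateau) version needed for `H^∞` is the line of `NestedHillProfile.lean` (refuter4). WHAT THIS IS NOT:
no slice is constructed here and S⁺ is NOT item 19249 — a refutation of S⁺ says exactly that any proof of
`HeredityAtOne` must use REGISTRATION HISTORY of the level-1 slice beyond its envelope (letter + ceiling), cf.
`lazy_envelope_slice_not_registered`. No verdict change on 19249.

References: Gallay–Šverák 2015 [cite: GallaySverak2016, Thm. 1.1, Prop. 2.6 (2.14)]; Lemarié-Rieusset 2016, Thm. 10.4
[cite: LemarieRieusset2016, Thm. 10.4 (p. 285)]; Tao 2013 [cite: Tao2011, Thm. 5.4]; Palasek 2026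
[cite: Palasek2026ElementaryModel, §4]; Hill 1894 / Saffman, *Vortex Dynamics* §§2.1, 3.2 [folklore].
-/

noncomputable section

namespace Summit.NavierStokesRegularity.HeredityAtOneNoSwirlStratum

open Set MeasureTheory Filter Topology Function
open scoped ENNReal NNReal ContDiff
open Literature.Analysis.FluidPDE
open Summit.NavierStokesRegularity.FluidComputer
open Summit.NavierStokesRegularity.FluidComputer.PalasekTowerClayBridge
open Summit.NavierStokesRegularity.NavierStokesRegularity
open Summit.NavierStokesRegularity.HeredityAtOneNoSwirlCap

/-! ## §1 Every `H^∞` signed swirl-free slice launches a capped unforced run of any length -/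

/-- **LUY + GS, classical rendering.** For a cap constant `C`, a smooth divergence-free slice `v` all of whose
derivatives are square integrable (no pointwise decay asked), single-signed swirl-free with height `M`, and any
`T > 0`: there is a classical finite-energy solution `(w, r)` of the UNFORCED system on `[0, T] × ℝ³` with
`w 0 = v` and `‖w(σ, x)‖ ≤ C √(√((∫η)(∫r²η)) M)` throughout. (Tao-class global solution from `H^∞` swirl-free data,
`exists_isTaoSolutionOn_of_noSwirl` with both named inputs discharged; the cap on Tao's class.)
[cite: LemarieRieusset2016, Thm. 10.4 (p. 285)] [cite: GallaySverak2016, Prop. 2.6 (2.14)] -/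
theorem exists_capped_run_of_signedNoSwirlSlice {C : ℝ} (hC : IsNoSwirlCapConstant C)
    {v : EuclideanSpace ℝ (Fin 3) → EuclideanSpace ℝ (Fin 3)} (hsm : ContDiff ℝ ∞ v)
    (hdiv : VectorCalculus.IsDivFree v) (hH : ∀ n : ℕ, ∫⁻ x, ‖iteratedFDeriv ℝ n v x‖ₑ ^ 2 < ⊤) {M : ℝ}
    (hsl : SignedNoSwirlSlice v M) {T : ℝ} (hT : 0 < T) :
    ∃ (w : ℝ → EuclideanSpace ℝ (Fin 3) → EuclideanSpace ℝ (Fin 3)) (r : ℝ → EuclideanSpace ℝ (Fin 3) → ℝ),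
      IsClassicalNSSolutionOn (Icc 0 T) 1 0 w r ∧ w 0 = v ∧
      (∃ C' : ℝ≥0∞, C' < ⊤ ∧ ∀ σ ∈ Icc 0 T, ∫⁻ x, ‖w σ x‖ₑ ^ 2 ≤ C') ∧
      ∀ σ ∈ Icc 0 T, ∀ x,
        ‖w σ x‖ ≤ C * Real.sqrt (Real.sqrt ((∫ y, angVortQuot v y) *
          ∫ y, cylRadius y ^ 2 * angVortQuot v y) * M) := by
  obtain ⟨w, r, hTao⟩ := exists_isTaoSolutionOn_of_noSwirl tao2011_smooth_local_existence_holds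
    axisymmetricNoSwirl_enstrophy_apriori_holds one_pos hsm hdiv hH hsl.axisym hsl.noSwirl hT
  refine ⟨w, r, hTao.classical, hTao.initial, ?_, fun σ hσ x => ?_⟩
  · obtain ⟨C₀, hC₀⟩ := hTao.sobolev 0
    exact ⟨C₀, ENNReal.coe_lt_top, fun σ hσ => by
      rw [lintegral_enorm_sq_eq_lintegral_iteratedFDeriv_zero]; exact hC₀ σ hσ⟩
  · exact hC.2 hT hTao hsl.axisym hsl.noSwirl hsl.nonneg hsl.le hsl.integrable hsl.integrable_sq σ hσ x

/-- The same with the NUMBER `0.35356` (`isNoSwirlCapConstant_eighth`; no cap-constant hypothesis).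
[cite: LemarieRieusset2016, Thm. 10.4 (p. 285)] [cite: GallaySverak2016, Prop. 2.6 (2.14)] -/
theorem exists_capped_run_of_signedNoSwirlSlice_eighth
    {v : EuclideanSpace ℝ (Fin 3) → EuclideanSpace ℝ (Fin 3)} (hsm : ContDiff ℝ ∞ v)
    (hdiv : VectorCalculus.IsDivFree v) (hH : ∀ n : ℕ, ∫⁻ x, ‖iteratedFDeriv ℝ n v x‖ₑ ^ 2 < ⊤) {M : ℝ}
    (hsl : SignedNoSwirlSlice v M) {T : ℝ} (hT : 0 < T) :
    ∃ (w : ℝ → EuclideanSpace ℝ (Fin 3) → EuclideanSpace ℝ (Fin 3)) (r : ℝ → EuclideanSpace ℝ (Fin 3) → ℝ),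
      IsClassicalNSSolutionOn (Icc 0 T) 1 0 w r ∧ w 0 = v ∧
      (∃ C' : ℝ≥0∞, C' < ⊤ ∧ ∀ σ ∈ Icc 0 T, ∫⁻ x, ‖w σ x‖ₑ ^ 2 ≤ C') ∧
      ∀ σ ∈ Icc 0 T, ∀ x,
        ‖w σ x‖ ≤ 0.35356 * Real.sqrt (Real.sqrt ((∫ y, angVortQuot v y) *
          ∫ y, cylRadius y ^ 2 * angVortQuot v y) * M) :=
  exists_capped_run_of_signedNoSwirlSlice isNoSwirlCapConstant_eighth hsm hdiv hH hsl hT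

/-! ## §2 A capped signed slice fails every `SliceRun … (Letter …)` — any wide design with `c₁ ≤ c₂`, any level -/

/-- **The capped run is a lazy tame run.** For a wide design `S` with `c₁ ≤ c₂`, a level `k`, a cap constant `C`
and a smooth divergence-free `H^∞` single-signed swirl-free slice `v` with `C·(cap value) < c₁ Y_{k+1}`:
`¬ SliceRun S k (Letter · (k+1)) v` — the run of §1 of length `τ_{k+1} − τ_k` is unforced, finite-energy, inside
the ceiling `c₂ Y_{k+1}`, and its terminal slice misses the speed floor `c₁ Y_{k+1}` at EVERY point.
[cite: GallaySverak2016, Prop. 2.6 (2.14)] [cite: Palasek2026ElementaryModel, §3.1] -/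
theorem not_sliceRun_letter_of_capped_signedNoSwirlSlice {C : ℝ} (hC : IsNoSwirlCapConstant C)
    {S : Schedule TowerRates.wide} (hc : S.c₁ ≤ S.c₂) {k : ℕ}
    {v : EuclideanSpace ℝ (Fin 3) → EuclideanSpace ℝ (Fin 3)} (hsm : ContDiff ℝ ∞ v)
    (hdiv : VectorCalculus.IsDivFree v) (hH : ∀ n : ℕ, ∫⁻ x, ‖iteratedFDeriv ℝ n v x‖ₑ ^ 2 < ⊤) {M : ℝ}
    (hsl : SignedNoSwirlSlice v M)
    (hlt : C * Real.sqrt (Real.sqrt ((∫ y, angVortQuot v y) *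
        ∫ y, cylRadius y ^ 2 * angVortQuot v y) * M) < S.c₁ * TowerRates.wide.Y (k + 1)) :
    ¬ SliceRun S k (fun S w => Letter S (k + 1) w) v := by
  have hT : 0 < S.τ (k + 1) - S.τ k := sub_pos.2 (S.τ_lt_succ k)
  obtain ⟨w, r, hw, hw0, hE, hcap⟩ := exists_capped_run_of_signedNoSwirlSlice hC hsm hdiv hH hsl hT
  have hY : 0 < TowerRates.wide.Y (k + 1) := Real.rpow_pos_of_pos (TowerRates.wide.N_pos (k + 1)) _
  have h12 : S.c₁ * TowerRates.wide.Y (k + 1) ≤ S.c₂ * TowerRates.wide.Y (k + 1) :=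
    mul_le_mul_of_nonneg_right hc hY.le
  intro h
  obtain ⟨⟨x, -, hx⟩, -, -⟩ := h w r hw hw0 hE fun σ hσ x => ((hcap σ hσ x).trans hlt.le).trans h12
  exact absurd (hx.trans (hcap _ ⟨hT.le, le_rfl⟩ x)) (not_le.2 hlt)

/-! ## §3 S⁺ = `SliceHeredityAtOne` reduced to a KINEMATIC remainder -/

/-- **S⁺ dies on ONE capped signed swirl-free envelope slice** (S⁺ = `SliceHeredityAtOne` of
`Cruxes/HeredityAtOne/StrategyCensus.lean`, stated here VERBATIM by its body — a `Theorems` file may not import a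
`Cruxes` module; bridge by `Iff.rfl`). ONE pinned rigid quiet wide design with `c₁ ≤ c₂`, ONE smooth
divergence-free `H^∞` single-signed swirl-free slice `v` in its level-1 envelope (level-1 letter in the ball and
ceiling `c₂ Y₁`) with `0.35356·(cap value) < c₁ Y₂` refute S⁺ — NO run, NO stage, NO history is asked any more
(§1 supplies the lazy tame run). [cite: GallaySverak2016, Prop. 2.6 (2.14)] [cite: LemarieRieusset2016, Thm. 10.4 (p. 285)] [cite: Palasek2026ElementaryModel, §4] -/
theorem not_sliceHeredityAtOne_of_capped_signed_envelope_slice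
    (hW : ∃ (S : Schedule TowerRates.wide) (v : EuclideanSpace ℝ (Fin 3) → EuclideanSpace ℝ (Fin 3)) (M : ℝ),
      S.Pins 8 (6 / 5) ∧ S.Rigid ∧ S.Quiet ∧ S.c₁ ≤ S.c₂ ∧
      (Letter S 1 v ∧ ∀ x, ‖v x‖ ≤ S.c₂ * TowerRates.wide.Y 1) ∧
      ContDiff ℝ ∞ v ∧ VectorCalculus.IsDivFree v ∧ (∀ n : ℕ, ∫⁻ x, ‖iteratedFDeriv ℝ n v x‖ₑ ^ 2 < ⊤) ∧
      SignedNoSwirlSlice v M ∧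
      0.35356 * Real.sqrt (Real.sqrt ((∫ y, angVortQuot v y) *
        ∫ y, cylRadius y ^ 2 * angVortQuot v y) * M) < S.c₁ * TowerRates.wide.Y 2) :
    ¬ ∀ S : Schedule TowerRates.wide, S.Pins 8 (6 / 5) → S.Rigid → S.Quiet →
        ∀ v : EuclideanSpace ℝ (Fin 3) → EuclideanSpace ℝ (Fin 3),
          (Letter S 1 v ∧ ∀ x, ‖v x‖ ≤ S.c₂ * TowerRates.wide.Y 1) →
            SliceRun S 1 (fun S w => Letter S 2 w) v := by
  obtain ⟨S, v, M, hP, hR, hQ, hc, henv, hsm, hdiv, hH, hsl, hlt⟩ := hW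
  intro h
  exact not_sliceRun_letter_of_capped_signedNoSwirlSlice isNoSwirlCapConstant_eighth hc hsm hdiv hH hsl hlt
    (h S hP hR hQ v henv)

/-- The same remainder kills the slice form of item 19249's lower stubs AT A REGISTERED SLICE only: if the
`τ₁`-slice of a registered level-1 stage of a pinned rigid quiet wide design with `c₁ ≤ c₂` is such a capped
signed slice, `ReadoutFloorsAt 1` fails (via `readoutFloorsAt_one_iff_sliceRun`) — the registered (empty-in-
practice) version, for comparison with the design-free one above. [cite: Palasek2026ElementaryModel, §4] -/
theorem not_readoutFloorsAt_one_of_capped_signed_registered_slice {S : Schedule TowerRates.wide}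
    (hP : S.Pins 8 (6 / 5)) (hR : S.Rigid) (hQ : S.Quiet)
    (s : Stage 1 TowerRates.wide S (Margins.routeG TowerRates.wide) 1)
    (hsm : ContDiff ℝ ∞ (s.u (S.τ 1))) (hdiv : VectorCalculus.IsDivFree (s.u (S.τ 1)))
    (hH : ∀ n : ℕ, ∫⁻ x, ‖iteratedFDeriv ℝ n (s.u (S.τ 1)) x‖ₑ ^ 2 < ⊤) {M : ℝ}
    (hsl : SignedNoSwirlSlice (s.u (S.τ 1)) M)
    (hlt : 0.35356 * Real.sqrt (Real.sqrt ((∫ y, angVortQuot (s.u (S.τ 1)) y) *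
        ∫ y, cylRadius y ^ 2 * angVortQuot (s.u (S.τ 1)) y) * M) < S.c₁ * TowerRates.wide.Y 2) :
    ¬ ReadoutFloorsAt 1 := fun h =>
  not_sliceRun_letter_of_capped_signedNoSwirlSlice isNoSwirlCapConstant_eighth s.c₁_le_c₂ hsm hdiv hH hsl hlt
    (readoutFloorsAt_one_iff_sliceRun.1 h S hP hR hQ s)

end Summit.NavierStokesRegularity.HeredityAtOneNoSwirlStratum

end
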